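import Literature.AnabelianGeometry.SemiGraphs.PSCVertCountConnectivityStable
import Literature.AnabelianGeometry.SemiGraphs.PSCTwoComponentShape
import HarnessLib

/-!
# [CombGC] Rmk. 1.1.3 `i(G_U) ≤ n(G_U) + 1` at the IRREDUCIBLE NODAL shape (one vertex, self-nodes; HNN stable letter)

Mochizuki, *A combinatorial version of the Grothendieck conjecture* [CombGC] §1, Def. 1.1 (i)(ii) p. 6,
Rmk. 1.1.3 p. 8 [cite: MochizukiCombGC2007, Rmk 1.1.3 p.8]; [IUTchI] Rmk. 1.2.3 (i) p. 41
[cite: Mochizuki2012, IUTchI Rmk 1.2.3(i) p.41]; [SemiAnbd] Ex. 2.10 p. 31 (surface groups)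
[cite: MochizukiSemiAnbd2006, Ex. 2.10 p.31].

Sequel of `PSCVertCountConnectivityStable.lean` (abc-iut-w4-d052; the criterion with STABLE LETTERS).
PROOF-ONLY (no definitions).  The first instance of the sub-node row F-3810
`PSCDatum.VertCountLeNodeCountSucc` at a ONE-VERTEX datum WITH A SELF-NODE whose verticial group is a
PROPER subgroup — the shape Def. 1.1 extracts from an IRREDUCIBLE NODAL curve of arithmetic genus
`g + 1` (normalisation of genus `g` with the two branches of the node): along a pro-`Σ` completion
`ι : Γ_{g+1,0} → Π` of the surface group of the smoothing, with `x := a_g`, `t := b_g` the last handle,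
the relator `∏_{i<g}[a_i,b_i] · [x,t] = 1` exhibits `Γ_{g+1,0}` as the HNN extension of the free group
`F = ⟨a_i, b_i (i < g), x⟩` (the fundamental group of the genus-`g` surface minus the two branch points,
rank `2g + 1`) along `t x t⁻¹ = (∏_{i<g}[a_i,b_i]) · x ∈ F`:

* verticial group `Π_v = closure ι(F)`, node group(s) `Π_e = closure ι⟨x⟩`, stable letter `ι(t)` with
  `ι(t) Π_e ι(t)⁻¹ ≤ Π_v` (`conj_nodeGp_le_of_irreducibleNodal`), and `⟨F, t⟩ = Γ_{g+1,0}` so that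
  `Π_v` and `ι(t)` topologically generate `Π`;
* `vertCountLeNodeCountSucc_of_irreducibleNodal` — every covering `G_U` has `i(G_U) ≤ n(G_U) + 1`
  (via `vertCountLeNodeCountSucc_of_oneVertex_stable`).  Here `Π_v ≠ Π` in general and the coverings
  have many vertices, so this is outside the `Π_v = Π` lemma of abc-iut-w5-d195.

Instance / consistency evidence for the typed schema at a genuine self-node shape; not the printed
statement for all pointed stable curves; nothing here takes a side on [IUTchIII] Cor. 3.12.
-/

noncomputable section

namespace Literature.AnabelianGeometry.SemiGraphs

universe u

namespace PSCDatum

open scoped Pointwise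
open Literature.GroupTheory.CombinatorialGroupTheory
open SemiGraphOfAnabelioids (IsProSigmaCompletion)

/-! ### The HNN structure of `Γ_{g+1,0}` along the last handle -/

/-- The relator of `Γ_{g+1,0}` split off at the last handle:
`(∏_{i<g}[a_i,b_i]) · (a_g b_g a_g⁻¹ b_g⁻¹) = 1`. [cite: MochizukiSemiAnbd2006, Ex. 2.10 p.31] -/
theorem prod_comm_castSucc_mul_comm_last (g : ℕ) :
    (List.ofFn fun i : Fin g =>
        PuncturedSurfaceGroup.a (g := g + 1) (r := 0) (Fin.castSucc i) * PuncturedSurfaceGroup.b (Fin.castSucc i) *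
          (PuncturedSurfaceGroup.a (Fin.castSucc i))⁻¹ * (PuncturedSurfaceGroup.b (Fin.castSucc i))⁻¹).prod *
      (PuncturedSurfaceGroup.a (g := g + 1) (r := 0) (Fin.last g) * PuncturedSurfaceGroup.b (Fin.last g) *
        (PuncturedSurfaceGroup.a (Fin.last g))⁻¹ * (PuncturedSurfaceGroup.b (Fin.last g))⁻¹) = 1 := by
  have hlast : Fin.natAdd g (0 : Fin 1) = Fin.last g := Fin.ext (by simp)
  have h := PuncturedSurfaceGroup.prod_comm_castAdd_mul_prod_comm_natAdd g 1
  rw [List.ofFn_succ, List.ofFn_zero, List.prod_cons, List.prod_nil, mul_one, hlast] at h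
  exact h

/-- **HNN conjugation**: `b_g a_g b_g⁻¹ = (∏_{i<g}[a_i,b_i]) · a_g` lies in the subgroup
`F = ⟨a_i, b_i (i < g), a_g⟩`. [cite: MochizukiSemiAnbd2006, Ex. 2.10 p.31] -/
theorem conj_last_mem_closure (g : ℕ) :
    PuncturedSurfaceGroup.b (g := g + 1) (r := 0) (Fin.last g) * PuncturedSurfaceGroup.a (Fin.last g) *
        (PuncturedSurfaceGroup.b (Fin.last g))⁻¹ ∈
      Subgroup.closure
        (Set.range (fun i : Fin g => PuncturedSurfaceGroup.a (g := g + 1) (r := 0) (Fin.castSucc i)) ∪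
          Set.range (fun i : Fin g => PuncturedSurfaceGroup.b (g := g + 1) (r := 0) (Fin.castSucc i)) ∪
          {PuncturedSurfaceGroup.a (g := g + 1) (r := 0) (Fin.last g)}) := by
  set F := Subgroup.closure
        (Set.range (fun i : Fin g => PuncturedSurfaceGroup.a (g := g + 1) (r := 0) (Fin.castSucc i)) ∪
          Set.range (fun i : Fin g => PuncturedSurfaceGroup.b (g := g + 1) (r := 0) (Fin.castSucc i)) ∪
          {PuncturedSurfaceGroup.a (g := g + 1) (r := 0) (Fin.last g)}) with hF
  set W := (List.ofFn fun i : Fin g =>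
        PuncturedSurfaceGroup.a (g := g + 1) (r := 0) (Fin.castSucc i) * PuncturedSurfaceGroup.b (Fin.castSucc i) *
          (PuncturedSurfaceGroup.a (Fin.castSucc i))⁻¹ * (PuncturedSurfaceGroup.b (Fin.castSucc i))⁻¹).prod with hW
  set x := PuncturedSurfaceGroup.a (g := g + 1) (r := 0) (Fin.last g) with hx
  set t := PuncturedSurfaceGroup.b (g := g + 1) (r := 0) (Fin.last g) with ht
  have hWF : W ∈ F := by
    refine Subgroup.list_prod_mem _ fun y hy => ?_
    rw [List.mem_ofFn] at hy
    obtain ⟨i, rfl⟩ := hy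
    have ha : PuncturedSurfaceGroup.a (g := g + 1) (r := 0) (Fin.castSucc i) ∈ F :=
      Subgroup.subset_closure (Or.inl (Or.inl ⟨i, rfl⟩))
    have hb : PuncturedSurfaceGroup.b (g := g + 1) (r := 0) (Fin.castSucc i) ∈ F :=
      Subgroup.subset_closure (Or.inl (Or.inr ⟨i, rfl⟩))
    exact F.mul_mem (F.mul_mem (F.mul_mem ha hb) (F.inv_mem ha)) (F.inv_mem hb)
  have hxF : x ∈ F := Subgroup.subset_closure (Or.inr rfl)
  -- the relator `W · (x t x⁻¹ t⁻¹) = 1` gives `t x t⁻¹ = W x`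
  have hrel : W * (x * t * x⁻¹ * t⁻¹) = 1 := prod_comm_castSucc_mul_comm_last g
  have hconj : t * x * t⁻¹ = W * x := by
    have h1 : W * x * t = t * x := by
      calc W * x * t = W * (x * t * x⁻¹ * t⁻¹) * (t * x) := by group
        _ = t * x := by rw [hrel, one_mul]
    calc t * x * t⁻¹ = W * x * t * t⁻¹ := by rw [h1]
      _ = W * x := by group
  rw [hconj]
  exact F.mul_mem hWF hxF

/-- `⟨F, t⟩ = Γ_{g+1,0}`: the free subgroup `F = ⟨a_i, b_i (i < g), a_g⟩` and the stable letter
`t = b_g` generate. [cite: MochizukiSemiAnbd2006, Ex. 2.10 p.31] -/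
theorem closure_sup_zpowers_last_eq_top (g : ℕ) :
    Subgroup.closure
        (Set.range (fun i : Fin g => PuncturedSurfaceGroup.a (g := g + 1) (r := 0) (Fin.castSucc i)) ∪
          Set.range (fun i : Fin g => PuncturedSurfaceGroup.b (g := g + 1) (r := 0) (Fin.castSucc i)) ∪
          {PuncturedSurfaceGroup.a (g := g + 1) (r := 0) (Fin.last g)}) ⊔
      Subgroup.zpowers (PuncturedSurfaceGroup.b (g := g + 1) (r := 0) (Fin.last g)) = ⊤ := by
  classical
  rw [eq_top_iff]
  have hgen := PresentedGroup.closure_range_of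
    ({PuncturedSurfaceGroup.relator (g + 1) 0} : Set (FreeGroup (puncturedSurfaceGen (g + 1) 0)))
  refine (ge_of_eq hgen).trans ((Subgroup.closure_le _).mpr ?_)
  rintro _ ⟨y, rfl⟩
  rcases y with ⟨k, bb⟩ | j
  · induction k using Fin.lastCases with
    | last =>
      cases bb
      · exact Subgroup.mem_sup_left (Subgroup.subset_closure (Or.inr rfl))
      · exact Subgroup.mem_sup_right (Subgroup.mem_zpowers _)
    | cast i =>
      refine Subgroup.mem_sup_left (Subgroup.subset_closure (Or.inl ?_))
      cases bb
      · exact Or.inl ⟨i, rfl⟩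
      · exact Or.inr ⟨i, rfl⟩
  · exact j.elim0

/-! ### The irreducible nodal shape -/

variable {P : Type u} [Group P] [TopologicalSpace P] [IsTopologicalGroup P]

/-- **The stable letter conjugates the node group into the verticial group**: with
`Π_v = closure ι(F)`, `Π_e = closure ι⟨a_g⟩`, `ι(b_g) Π_e ι(b_g)⁻¹ ≤ Π_v`.
[cite: MochizukiCombGC2007, Def 1.1(ii) p.6] -/
theorem conj_nodeGp_le_of_irreducibleNodal {g : ℕ} (ι : PuncturedSurfaceGroup (g + 1) 0 →* P)
    (p : P) (hp : p ∈ ((Subgroup.zpowers (PuncturedSurfaceGroup.a (g := g + 1) (r := 0) (Fin.last g))).map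
      ι).topologicalClosure) :
    ι (PuncturedSurfaceGroup.b (Fin.last g)) * p * (ι (PuncturedSurfaceGroup.b (Fin.last g)))⁻¹ ∈
      ((Subgroup.closure
        (Set.range (fun i : Fin g => PuncturedSurfaceGroup.a (g := g + 1) (r := 0) (Fin.castSucc i)) ∪
          Set.range (fun i : Fin g => PuncturedSurfaceGroup.b (g := g + 1) (r := 0) (Fin.castSucc i)) ∪
          {PuncturedSurfaceGroup.a (g := g + 1) (r := 0) (Fin.last g)})).map ι).topologicalClosure := by
  set t : P := ι (PuncturedSurfaceGroup.b (g := g + 1) (r := 0) (Fin.last g)) with ht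
  set V := ((Subgroup.closure
        (Set.range (fun i : Fin g => PuncturedSurfaceGroup.a (g := g + 1) (r := 0) (Fin.castSucc i)) ∪
          Set.range (fun i : Fin g => PuncturedSurfaceGroup.b (g := g + 1) (r := 0) (Fin.castSucc i)) ∪
          {PuncturedSurfaceGroup.a (g := g + 1) (r := 0) (Fin.last g)})).map ι).topologicalClosure with hV
  -- the closed subgroup `{p | t p t⁻¹ ∈ V}` contains `ι⟨a_g⟩`, hence its closure
  let C : Subgroup P := V.comap (MulAut.conj t).toMonoidHom
  have hC : IsClosed (C : Set P) :=
    (Subgroup.isClosed_topologicalClosure _).preimage ((continuous_const.mul continuous_id).mul continuous_const)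
  have hle : (Subgroup.zpowers (PuncturedSurfaceGroup.a (g := g + 1) (r := 0) (Fin.last g))).map ι ≤ C := by
    rw [Subgroup.map_le_iff_le_comap, Subgroup.zpowers_le]
    change t * ι (PuncturedSurfaceGroup.a (Fin.last g)) * t⁻¹ ∈ V
    rw [ht, ← map_mul, ← map_inv, ← map_mul]
    exact Subgroup.le_topologicalClosure _ (Subgroup.mem_map_of_mem ι (conj_last_mem_closure g))
  exact Subgroup.topologicalClosure_minimal _ hle hC hp

/-- **Irreducible nodal shape: `i(G_U) ≤ n(G_U) + 1`.**  One vertex `v₀` with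
`Π_{v₀} = closure ι⟨a_i, b_i (i < g), a_g⟩` along a pro-`Σ` completion `ι : Γ_{g+1,0} → Π` (any `Σ`),
at least one node, every node group `closure ι⟨a_g⟩` (the non-separating vanishing cycle): every
covering `G_U` has `i(G_U) ≤ n(G_U) + 1` — stable letter `ι(b_g)`.  First instance of F-3810 at a
self-node shape with `Π_{v₀} ≠ Π`. [cite: MochizukiCombGC2007, Rmk 1.1.3 p.8] -/
theorem vertCountLeNodeCountSucc_of_irreducibleNodal [CompactSpace P] (G : PSCDatum P) {S : Set ℕ}
    {g : ℕ} (ι : PuncturedSurfaceGroup (g + 1) 0 →* P) (hι : IsProSigmaCompletion S ι)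
    (v₀ : G.graph.V) (hV : ∀ w, w = v₀) (e₀ : G.graph.N)
    (hV₀ : G.vertGp v₀ = ((Subgroup.closure
        (Set.range (fun i : Fin g => PuncturedSurfaceGroup.a (g := g + 1) (r := 0) (Fin.castSucc i)) ∪
          Set.range (fun i : Fin g => PuncturedSurfaceGroup.b (g := g + 1) (r := 0) (Fin.castSucc i)) ∪
          {PuncturedSurfaceGroup.a (g := g + 1) (r := 0) (Fin.last g)})).map ι).topologicalClosure)
    (hN : ∀ e, G.nodeGp e =
      ((Subgroup.zpowers (PuncturedSurfaceGroup.a (g := g + 1) (r := 0) (Fin.last g))).map ι).topologicalClosure) :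
    G.VertCountLeNodeCountSucc := by
  classical
  set t : P := ι (PuncturedSurfaceGroup.b (g := g + 1) (r := 0) (Fin.last g)) with ht
  refine vertCountLeNodeCountSucc_of_oneVertex_stable G v₀ hV (fun _ => t) (fun e => ?_)
    (fun e p hp => ?_) ?_
  · -- `Π_e ≤ Π_{v₀}`
    rw [hN e, hV₀]
    exact Subgroup.topologicalClosure_mono (Subgroup.map_mono ((Subgroup.zpowers_le).mpr
      (Subgroup.subset_closure (Or.inr rfl))))
  · -- `t Π_e t⁻¹ ≤ Π_{v₀}`
    rw [hV₀]
    exact conj_nodeGp_le_of_irreducibleNodal ι p ((hN e) ▸ hp)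
  · -- `⟨Π_{v₀}, t⟩` is dense
    have hrange : Set.range (fun _ : G.graph.N => t) = {t} := by
      ext x
      simp only [Set.mem_range, Set.mem_singleton_iff]
      exact ⟨fun ⟨_, h⟩ => h.symm, fun h => ⟨e₀, h.symm⟩⟩
    rw [hrange, ← Subgroup.zpowers_eq_closure, hV₀, ht, ← MonoidHom.map_zpowers]
    have key := topologicalClosure_sup_eq_top_of_dense ι hι.dense (closure_sup_zpowers_last_eq_top g)
    rw [eq_top_iff, ← key]
    refine Subgroup.topologicalClosure_minimal _ (sup_le ?_ ?_) (Subgroup.isClosed_topologicalClosure _)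
    · exact (le_sup_left.trans (Subgroup.le_topologicalClosure _))
    · exact Subgroup.topologicalClosure_minimal _ (le_sup_right.trans (Subgroup.le_topologicalClosure _))
        (Subgroup.isClosed_topologicalClosure _)

end PSCDatum

end Literature.AnabelianGeometry.SemiGraphs

end
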